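import Summits.ABC.ABC.Theorems.TwistAmplificationSharpModerateLawUnitPlaneFlat6Defs

/-!
# Crux `TwistAmplification.SharpModerateLaw` (stmt-ABC-1975), line `unit-plane-conic-two-torsion`:
STUB B′ `stub_fewDeepFlat6` — the floor-free few-deep law of skeleton v3

Registered stub `stub_fewDeepFlat6 : FewDeepFlat6Law` (`= FewDeepLaw → LawWithConeE FewDeepFlat6 0`,
`…UnitPlaneFlat6Defs.lean`). The v3 few-deep population measures depth on `m♭⁶ = coprimePart 6 m` (every prime
`≥ 5` kept), so the repeated radical of the whole primitive value satisfies `v(m) ∣ 6·v(m♭⁶)`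
(`depthRad_dvd_six_mul`); hence a v3 few-deep datum at conductor budget `X` is in the companion's shell and
few-deep at budget `6X` (`fewDeep_of_fewDeepFlat6`), counts are monotone orbit by orbit
(`totalCount_fewDeepFlat6_le`), and the companion's `FewDeepLaw` at `(6X, Y)` gives the law with constant
`max C 0 · 6^{1+ε}` and NO floor (`lawWithConeE_fewDeepFlat6`). Kernel-checked first by the corner worker of
lead c3 (evidence `CornerReshapeCertified.lean`); landed here verbatim over the v3 Defs.
-/

noncomputable section

-- the mandated summit namespace `Summit.ABC.ABC` (summit = problem) trips the duplicate-namespace linter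
set_option linter.dupNamespace false

namespace Summit.ABC.ABC.Theorems.SharpModerateLaw.UnitPlane

open Literature.NumberTheory.CubicFields
open UniqueFactorizationMonoid (radical)
open FewDeepSlice

/-- `v(n) ∣ 6 · v(n♭⁶)`: passing to the 6-flat part loses at most the primes `2, 3` of the repeated radical. -/
theorem depthRad_dvd_six_mul (n : ℕ) (hn : n ≠ 0) : depthRad n ∣ 6 * depthRad (coprimePart 6 n) := by
  have hc0 : coprimePart 6 n ≠ 0 := (coprimePart_pos 6 n).ne'
  rw [← Nat.factorization_le_iff_dvd (depthRad_pos n).ne' (mul_ne_zero (by norm_num) (depthRad_pos _).ne')]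
  intro p
  by_cases hp : p.Prime
  · rw [factorization_depthRad hn hp, Nat.factorization_mul (by norm_num) (depthRad_pos _).ne', Finsupp.add_apply,
      factorization_depthRad hc0 hp]
    by_cases h2 : p ^ 2 ∣ n
    · rw [if_pos h2]
      by_cases hp6 : p ∣ 6
      · have : 1 ≤ (6 : ℕ).factorization p := (hp.dvd_iff_one_le_factorization (by norm_num)).mp hp6
        omega
      · have h2' : p ^ 2 ∣ coprimePart 6 n := by
          rw [hp.pow_dvd_iff_le_factorization hc0, factorization_coprimePart hn hp, if_neg hp6]
          exact (hp.pow_dvd_iff_le_factorization hn).mp h2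
        rw [if_pos h2']
        omega
    · rw [if_neg h2]
      exact Nat.zero_le _
  · simp [Nat.factorization_eq_zero_of_not_prime _ hp]

/-- **One datum, no floor**: a v3 few-deep datum at budget `X` is in the shell and syzygy-few-deep at budget `6X`. -/
theorem fewDeep_of_fewDeepFlat6 {F : BinaryCubic ℤ} {ε X Y : ℝ} (hX : 0 ≤ X) {q : ℤ × ℤ} (hq : q ∈ ifShell F X Y)
    (h : FewDeepFlat6 ε X Y F q) : q ∈ ifShell F (6 * X) Y ∧ FewDeep (6 * X) Y F q := by
  obtain ⟨hF, hH, hG, hC, hY1, hY2, hN⟩ := hq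
  refine ⟨⟨hF, hH, hG, hC, hY1, hY2, hN.trans (by linarith)⟩, ?_⟩
  have hm0 : primValue F q ≠ 0 := by
    intro h0
    have e := smul_ediv_gcd q
    have h0' : F.eval (q.1 / (Int.gcd q.1 q.2 : ℤ)) (q.2 / (Int.gcd q.1 q.2 : ℤ)) = 0 := Int.natAbs_eq_zero.mp h0
    apply hF
    rw [← e, eval_smul', h0', mul_zero]
  have hle : ((depthRad (primValue F q) : ℕ) : ℝ) ≤ 6 * ((depthRad (mflat6 F q) : ℕ) : ℝ) := by
    have := Nat.le_of_dvd (Nat.mul_pos (by norm_num) (depthRad_pos _)) (depthRad_dvd_six_mul _ hm0)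
    exact_mod_cast this
  set A : ℝ := ((Int.gcd q.1 q.2 : ℕ) : ℝ) * ((radical F.disc.natAbs : ℕ) : ℝ) with hA
  have hA0 : 0 ≤ A := by positivity
  have h' : A * ((depthRad (mflat6 F q) : ℕ) : ℝ) ≤ X * Y ^ (-(1 / 6 : ℝ)) := h
  show A * ((depthRad (primValue F q) : ℕ) : ℝ) ≤ 6 * X * Y ^ (-(1 / 6 : ℝ))
  calc A * ((depthRad (primValue F q) : ℕ) : ℝ) ≤ A * (6 * ((depthRad (mflat6 F q) : ℕ) : ℝ)) :=
        mul_le_mul_of_nonneg_left hle hA0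
    _ = 6 * (A * ((depthRad (mflat6 F q) : ℕ) : ℝ)) := by ring
    _ ≤ 6 * (X * Y ^ (-(1 / 6 : ℝ))) := by gcongr
    _ = 6 * X * Y ^ (-(1 / 6 : ℝ)) := by ring

/-- Per form, no floor: the v3 few-deep slice at budget `X` is at most the companion's few-deep slice at `6X`. -/
theorem shellCount_fewDeepFlat6_le {ε X : ℝ} (hX : 0 ≤ X) (Y : ℝ) (F : BinaryCubic ℤ) :
    shellCount (FewDeepFlat6 ε) X Y F ≤ shellCount FewDeep (6 * X) Y F := by
  unfold shellCount
  by_cases hM : RingOfForm.IsMaximal F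
  · have hD : F.disc ≠ 0 := hM.disc_ne_zero
    refine Set.ncard_le_ncard (fun q hq => ⟨hq.1, fewDeep_of_fewDeepFlat6 hX hq.2.1 hq.2.2⟩) ?_
    exact (FewDeepSlice.finite_mplus_le hD ⌈2 * Y⌉₊).subset fun q hq => by
      have hlt : (Mplus F q : ℝ) < 2 * Y := hq.2.1.2.2.2.2.2.1
      exact_mod_cast (hlt.le.trans (Nat.le_ceil _) : (Mplus F q : ℝ) ≤ ⌈2 * Y⌉₊)
  · rw [Set.eq_empty_of_forall_notMem
        (s := {q : ℤ × ℤ | RingOfForm.IsMaximal F ∧ q ∈ ifShell F X Y ∧ FewDeepFlat6 ε X Y F q})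
        fun q hq => hM hq.1, Set.ncard_empty]
    exact Nat.zero_le _

/-- In total, no floor. -/
theorem totalCount_fewDeepFlat6_le {ε X : ℝ} (hX : 0 ≤ X) (Y : ℝ) :
    totalCount (FewDeepFlat6 ε) X Y ≤ totalCount FewDeep (6 * X) Y := by
  unfold totalCount
  exact Finset.sum_le_sum fun D hD =>
    orbitTotal_mono (Finset.mem_erase.mp hD).1 fun F => shellCount_fewDeepFlat6_le hX Y F

/-- **The v3 few-deep law needs no floor**: `FewDeepLaw → LawWithConeE FewDeepFlat6 0`, constant `max C 0 · 6^{1+ε}`. -/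
theorem lawWithConeE_fewDeepFlat6 (h : FewDeepLaw) : LawWithConeE FewDeepFlat6 0 := by
  intro σ _ ε hε
  obtain ⟨C, hC⟩ := h ε hε
  refine ⟨max C 0 * (6 : ℝ) ^ (1 + ε), fun X Y hX hY _ _ => ?_⟩
  have hX0 : 0 < X := by linarith
  have hY0 : 0 < Y := by linarith
  have h1 := hC (6 * X) Y (by linarith) hY
  have hcount : (totalCount (FewDeepFlat6 ε) X Y : ℝ) ≤ (totalCount FewDeep (6 * X) Y : ℝ) := by
    exact_mod_cast totalCount_fewDeepFlat6_le hX0.le Y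
  have e1 : (6 * X * Y) ^ ε = (6 : ℝ) ^ ε * (X * Y) ^ ε := by
    rw [mul_assoc]; exact Real.mul_rpow (by norm_num) (by positivity)
  have e2 : (6 : ℝ) ^ (1 + ε) = 6 * (6 : ℝ) ^ ε := by
    rw [Real.rpow_add (by norm_num), Real.rpow_one]
  set Q : ℝ := (X * Y) ^ ε * (X * Y ^ (-(1 / 6 : ℝ)) + 0) with hQ
  have hQ0 : 0 ≤ Q := by positivity
  have hP : (6 * X * Y) ^ ε * (6 * X * Y ^ (-(1 / 6 : ℝ)) + 0) = (6 : ℝ) ^ (1 + ε) * Q := by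
    rw [e1, e2, hQ]; ring
  calc (totalCount (FewDeepFlat6 ε) X Y : ℝ) ≤ (totalCount FewDeep (6 * X) Y : ℝ) := hcount
    _ ≤ C * (6 * X * Y) ^ ε * (6 * X * Y ^ (-(1 / 6 : ℝ)) + 0) := h1
    _ = C * ((6 : ℝ) ^ (1 + ε) * Q) := by rw [mul_assoc, hP]
    _ ≤ max C 0 * ((6 : ℝ) ^ (1 + ε) * Q) := mul_le_mul_of_nonneg_right (le_max_left _ _) (by positivity)
    _ = max C 0 * (6 : ℝ) ^ (1 + ε) * (X * Y) ^ ε * (X * Y ^ (-(1 / 6 : ℝ)) + 0) := by rw [hQ]; ring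

/-- **Registered stub `stub_fewDeepFlat6` of crux stmt-ABC-1975** (line `unit-plane-conic-two-torsion`, skeleton v3):
the companion's few-deep law gives the floor-free v3 few-deep law. -/
theorem stub_fewDeepFlat6 : FewDeepFlat6Law := fun h => lawWithConeE_fewDeepFlat6 h

end Summit.ABC.ABC.Theorems.SharpModerateLaw.UnitPlane

end
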